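import Literature.AlgebraicGeometry.Pohlmann1968.HodgeClassesProductSpanCMProductsSplit
import Literature.AlgebraicGeometry.Pohlmann1968.HodgeClassesProductSpanCMProductsFrame
import Literature.FieldTheory.AlgClosed.AutomorphismExtension
import HarnessLib

/-!
# Hodge classes on `X × Y` for CM products: the product-span property FORCES block splitting of balanced weights
# (the converse of `…CMProductsSplit`; so `HodgeClassesProductSpan (⨁ A) (⨁ A')` ⟺ every glued-balanced weight splits)

Family `hodge`, layer `Literature/AlgebraicGeometry/Pohlmann1968`; cell `pub-hodgecm2` (COR-CM), count-neutral own-lane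
sequel of `Pohlmann1968/HodgeClassesProductSpanCMProductsSplit` (block splitting ⟹ product span) and `…CMProductsRank`.
HONEST FRAMING: unconditional structure theorem on Hodge classes of CM abelian varieties; not a step of the summit chain.

THE THEOREM (`blocksSplit_of_hodgeClassesProductSpan_biproduct`).  `X = ⨁ A_i`, `Y = ⨁ A'_j` products of realisations
of CM types `Φ_i` of `K_i`, `Φ'_j` of `K'_j`.  If `HodgeTheory.HodgeClassesProductSpan X Y` (every rational Hodge class on
`X × Y` is a `ℂ`-combination of exterior products of rational Hodge classes of the factors), then every weight
`S ⊆ (⊔_i Hom(K_i,ℂ)) ⊔ (⊔_j Hom(K'_j,ℂ))` balanced for the glued CM pair with value `p` has balanced blocks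
`S.toLeft ∈ pohlmannSetsAlg Φ p₁`, `S.toRight ∈ pohlmannSetsAlg Φ' p₂`, `p₁ + p₂ = p`.  With `…CMProductsSplit` this is an
EQUIVALENCE (`hodgeClassesProductSpan_biproduct_iff_blocksSplit`): the exact, weight-by-weight form of Moonen–Zarhin's
criterion (3.1) for the given pair `(X, Y)`.

PROOF (Pohlmann's theorem, BOTH halves, on `X × Y` and on the factors).  In the Künneth eigenbasis `u` of `H¹(X × Y)`
(the frame `exists_kunnethMonomialFrame` of `…CMProductsFrame`) the cup monomials `b_T` form a basis of `H^{2p}(X × Y)` diagonalising the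
rational operator `R = (ι(a) × ι'(a'))^*` with pairwise distinct eigenvalues.  (1) The glued-balanced `2p`-sets form a
Galois-stable family of monomials of type `(p,p)`, so `b_S ∈ B^p(X × Y) ⊗ ℂ` by the DESCENT half of the engine
(`monomial_mem_span_of_stable`; `Aut(ℂ)`-invariants of `ℂ` are rational).  (2) An exterior product `pr_X^* α ∪ pr_Y^* β` of
rational Hodge classes decomposes (Pohlmann for `X` and for `Y`, `mem_iSup_weightClassesAlg`) into products of weight
classes `α_{T₁}`, `β_{T₂}` with `T₁`, `T₂` BALANCED; each such product is an `R`-eigenvector for the eigenvalue of the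
split set `T₁ ⊔ T₂` (naturality of cup products, `cupProduct_map`), hence a multiple of `b_{T₁ ⊔ T₂}`.  (3) By the
hypothesis `b_S` lies in the span of the `b_T` with split `T`; `b` being a basis, `S` splits.  Theorems only; no definition,
no named fact; axioms `propext`, `Classical.choice`, `Quot.sound`.

## References
* [MoonenZarhin1999LowDim] B. Moonen, Yu. Zarhin, Math. Ann. 315 (1999) 711–733, §3 (3.1).
* [GaoUllmo2025] Z. Gao, E. Ullmo, J. Inst. Math. Jussieu 25 (2025), Thm. 3.1 with proof (Pohlmann for a CM algebra).
* [Gordon1999HodgeAVSurvey] B. B. Gordon, *A survey of the Hodge conjecture for abelian varieties*, §9.2 with proof.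
* [Cox2013] D. A. Cox, *Galois Theory*, 2nd ed., §10.C (automorphisms of `ℂ`).
-/

noncomputable section

open CategoryTheory CategoryTheory.Limits NumberField

namespace Literature.AlgebraicGeometry.Pohlmann1968

open Module
open Literature.AlgebraicTopology.SingularHomology
open Literature.AlgebraicGeometry.Motives (AbelianVariety CMType IsSmoothProjective ComplexPoints)
open Literature.AlgebraicGeometry.HodgeTheory
open Literature.AlgebraicGeometry.ComplexMultiplication (IsCMTypeRealisation)
open Literature.AlgebraicGeometry.VanGeemen1994 (hodgeClassSpan)

/-! ### Private helpers (copies of the engine files' private lemmas) -/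

/-- If an operator acts on a basis by pairwise distinct scalars, an eigenvector for one of these scalars is a
multiple of the corresponding basis vector. [folklore] -/
private theorem mem_span_singleton_of_apply_eq_smul₃ {ι M : Type*} [Fintype ι] [AddCommGroup M]
    [Module ℂ M] (b : Basis ι ℂ M) (φ : M →ₗ[ℂ] M) (lam : ι → ℂ)
    (hφ : ∀ i, φ (b i) = lam i • b i) (hlam : Function.Injective lam) {x : M} {i₀ : ι}
    (hx : φ x = lam i₀ • x) : x ∈ ℂ ∙ b i₀ := by
  have hx' : ∑ i, (b.repr x i * lam i - lam i₀ * b.repr x i) • b i = 0 := by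
    simp only [sub_smul, Finset.sum_sub_distrib, mul_smul]
    rw [sub_eq_zero]
    have h1 : φ x = ∑ i, b.repr x i • lam i • b i := by
      conv_lhs => rw [← b.sum_repr x]
      simp only [map_sum, map_smul, hφ]
    have h2 : lam i₀ • x = ∑ i, lam i₀ • b.repr x i • b i := by
      conv_lhs => rw [← b.sum_repr x]
      rw [Finset.smul_sum]
    rw [← h1, ← h2, hx]
  have hcoef := Fintype.linearIndependent_iff.1 b.linearIndependent _ hx'
  have hzero : ∀ i, i ≠ i₀ → b.repr x i = 0 := by
    intro i hi
    have h := hcoef i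
    rw [mul_comm (lam i₀), ← mul_sub, mul_eq_zero] at h
    rcases h with h | h
    · exact h
    · exact absurd (hlam (sub_eq_zero.1 h)) hi
  rw [Submodule.mem_span_singleton]
  refine ⟨b.repr x i₀, ?_⟩
  conv_rhs => rw [← b.sum_repr x]
  rw [Finset.sum_eq_single i₀ (fun i _ hi => by rw [hzero i hi, zero_smul])
    (fun h => absurd (Finset.mem_univ i₀) h)]

/-- **A complex number fixed by every automorphism of `ℂ` is rational.** [cite: Cox2013, §10.C proof of Thm. 10.23] -/
private theorem mem_range_algebraMap_rat_of_forall_ringEquiv₃ {x : ℂ}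
    (h : ∀ τ : ℂ ≃+* ℂ, (τ : ℂ →+* ℂ) x = x) : x ∈ Set.range (algebraMap ℚ ℂ) := by
  classical
  have hmem : ∀ σ : ℂ ≃+* ℂ, σ x ∈ ({x} : Finset ℂ) := fun σ => by
    rw [Finset.mem_singleton]; exact h σ
  have hint : IsIntegral ℚ x :=
    Literature.FieldTheory.AlgClosed.Complex.isIntegral_of_forall_ringEquiv_mem
      (Finset.finite_toSet {x}) (by simpa using hmem)
  have hle : (minpoly ℚ x).natDegree ≤ 1 := by
    simpa using Literature.FieldTheory.AlgClosed.Complex.natDegree_minpoly_le_card hmem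
  have hge : 0 < (minpoly ℚ x).natDegree := minpoly.natDegree_pos hint
  have hdeg : (minpoly ℚ x).degree = 1 := by
    rw [Polynomial.degree_eq_natDegree (minpoly.ne_zero hint)]
    exact_mod_cast le_antisymm hle hge
  obtain ⟨q, hq⟩ := minpoly.mem_range_of_degree_eq_one ℚ x hdeg
  exact ⟨q, hq⟩

/-- Counting the members of `s.map f` with a property = counting the members of `s` whose image has it. [folklore] -/
private theorem ncard_sep_map_eq₃ {α β : Type*} (f : α ↪ β) (s : Finset α) (Q : β → Prop) :
    {i | i ∈ s.map f ∧ Q i}.ncard = {j | j ∈ s ∧ Q (f j)}.ncard := by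
  rw [show {i | i ∈ s.map f ∧ Q i} = f '' {j | j ∈ s ∧ Q (f j)} by
      ext i
      simp only [Finset.mem_map, Set.mem_setOf_eq, Set.mem_image]
      constructor
      · rintro ⟨⟨j, hj, rfl⟩, hQ⟩; exact ⟨j, ⟨hj, hQ⟩, rfl⟩
      · rintro ⟨j, ⟨hj, hQ⟩, rfl⟩; exact ⟨⟨j, hj, rfl⟩, hQ⟩,
    Set.ncard_image_of_injective _ f.injective]

/-- `#{z ∈ T | Q z} + #{z ∈ T | ¬Q z} = |T|`. [folklore] -/
private theorem ncard_add_ncard_not₃ {γ : Type*} (T : Finset γ) (Q : γ → Prop) :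
    {z | z ∈ T ∧ Q z}.ncard + {z | z ∈ T ∧ ¬ Q z}.ncard = T.card := by
  have hdisj : Disjoint {z | z ∈ T ∧ Q z} {z | z ∈ T ∧ ¬ Q z} :=
    Set.disjoint_left.mpr fun z hz hz' => hz'.2 hz.2
  have hunion : {z | z ∈ T ∧ Q z} ∪ {z | z ∈ T ∧ ¬ Q z} = (T : Set γ) := by
    ext z
    simp only [Set.mem_union, Set.mem_setOf_eq, Finset.mem_coe]
    tauto
  have hfin₁ : {z | z ∈ T ∧ Q z}.Finite := T.finite_toSet.subset fun z hz => hz.1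
  have hfin₂ : {z | z ∈ T ∧ ¬ Q z}.Finite := T.finite_toSet.subset fun z hz => hz.1
  rw [← Set.ncard_union_eq hdisj hfin₁ hfin₂, hunion, Set.ncard_coe_finset]

section Main

variable {n m : ℕ} {K : Fin n → Type} {K' : Fin m → Type}
  [∀ i, Field (K i)] [∀ i, NumberField (K i)] [∀ j, Field (K' j)] [∀ j, NumberField (K' j)]
  {Φ : ∀ i, CMType (K i)} {Φ' : ∀ j, CMType (K' j)}
  {A : Fin n → AbelianVariety ℂ} {A' : Fin m → AbelianVariety ℂ}
  {ι : ∀ i, 𝓞 (K i) →+* End (A i)} {ι' : ∀ j, 𝓞 (K' j) →+* End (A' j)}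
  {θ : ∀ i, K i →+* Module.End ℂ (complexBetti (A i).X 1)}
  {θ' : ∀ j, K' j →+* Module.End ℂ (complexBetti (A' j).X 1)}

/-- **Product span forces block splitting.**  For realisations `(A_i, ι_i, θ_i)` of CM types `Φ_i` of number fields `K_i`
(`i < n`) and `(A'_j, ι'_j, θ'_j)` of `Φ'_j` of `K'_j` (`j < m`): if `HodgeClassesProductSpan (⨁ A) (⨁ A')`, then every weight
`S ⊆ (⊔_i Hom(K_i,ℂ)) ⊔ (⊔_j Hom(K'_j,ℂ))` satisfying Pohlmann's condition for the glued pair with value `p` (for every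
`τ ∈ Aut(ℂ)` exactly `p` members have `τ ∘ s` inside the type and exactly `p` outside) has balanced blocks:
`S.toLeft ∈ pohlmannSetsAlg Φ p₁`, `S.toRight ∈ pohlmannSetsAlg Φ' p₂`, `p₁ + p₂ = p`.  Proof: module docstring.
[cite: MoonenZarhin1999LowDim, §3 (3.1)] [cite: GaoUllmo2025, Thm. 3.1 with proof] -/
theorem blocksSplit_of_hodgeClassesProductSpan_biproduct
    (hA : ∀ i, IsCMTypeRealisation (Φ i) (A i) (ι i) (θ i))
    (hA' : ∀ j, IsCMTypeRealisation (Φ' j) (A' j) (ι' j) (θ' j))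
    (hspan : HodgeClassesProductSpan (⨁ A) (⨁ A'))
    (S : Finset ((Σ i, (K i →+* ℂ)) ⊕ (Σ j, (K' j →+* ℂ)))) (p : ℕ)
    (hS : ∀ τ : ℂ ≃+* ℂ,
      {z | z ∈ S ∧ Sum.elim (fun x : (Σ i, (K i →+* ℂ)) => (τ : ℂ →+* ℂ).comp x.2 ∈ (Φ x.1).1)
        (fun y : (Σ j, (K' j →+* ℂ)) => (τ : ℂ →+* ℂ).comp y.2 ∈ (Φ' y.1).1) z}.ncard = p ∧
      {z | z ∈ S ∧ ¬ Sum.elim (fun x : (Σ i, (K i →+* ℂ)) => (τ : ℂ →+* ℂ).comp x.2 ∈ (Φ x.1).1)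
        (fun y : (Σ j, (K' j →+* ℂ)) => (τ : ℂ →+* ℂ).comp y.2 ∈ (Φ' y.1).1) z}.ncard = p) :
    ∃ p₁ p₂ : ℕ, p₁ + p₂ = p ∧ S.toLeft ∈ pohlmannSetsAlg Φ p₁ ∧ S.toRight ∈ pohlmannSetsAlg Φ' p₂ := by
  classical
  have hZ : IsSmoothProjective ((⨁ A).prod (⨁ A')).dim ((⨁ A).prod (⨁ A')).X :=
    Motives.AbelianVariety.isSmoothProjective_holds
  -- the Künneth eigen-frame of `X × Y` (block orders first)
  letI : LinearOrder (Σ i, (K i →+* ℂ)) :=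
    LinearOrder.lift' (Fintype.equivFin (Σ i, (K i →+* ℂ))) (Fintype.equivFin (Σ i, (K i →+* ℂ))).injective
  letI : LinearOrder (Σ j, (K' j →+* ℂ)) :=
    LinearOrder.lift' (Fintype.equivFin (Σ j, (K' j →+* ℂ))) (Fintype.equivFin (Σ j, (K' j →+* ℂ))).injective
  obtain ⟨a, a', u, b, perm, hb, hv10, hv01, hf, hsep, hperm_apply, hperm⟩ :=
    exists_kunnethMonomialFrame hA hA' (2 * p)
  let P : (Σ i, (K i →+* ℂ)) ⊕ₗ (Σ j, (K' j →+* ℂ)) → Prop := fun z =>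
    Sum.elim (fun x : (Σ i, (K i →+* ℂ)) => x.2 ∈ (Φ x.1).1)
      (fun y : (Σ j, (K' j →+* ℂ)) => y.2 ∈ (Φ' y.1).1) (ofLex z)
  let ev : (Σ i, (K i →+* ℂ)) ⊕ₗ (Σ j, (K' j →+* ℂ)) → ℂ := fun z =>
    Sum.elim (fun x : (Σ i, (K i →+* ℂ)) => x.2 ((a x.1 : 𝓞 (K x.1)) : K x.1))
      (fun y : (Σ j, (K' j →+* ℂ)) => y.2 ((a' y.1 : 𝓞 (K' y.1)) : K' y.1)) (ofLex z)
  -- abbreviations: the glued predicate in `τ`-form, the `2p`-sets, the split sets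
  let Q : (ℂ ≃+* ℂ) → (Σ i, (K i →+* ℂ)) ⊕ (Σ j, (K' j →+* ℂ)) → Prop := fun τ =>
    Sum.elim (fun x : (Σ i, (K i →+* ℂ)) => (τ : ℂ →+* ℂ).comp x.2 ∈ (Φ x.1).1)
      (fun y : (Σ j, (K' j →+* ℂ)) => (τ : ℂ →+* ℂ).comp y.2 ∈ (Φ' y.1).1)
  have hQP : ∀ τ z, P (perm τ z) ↔ Q τ (ofLex z) := by
    intro τ z
    rw [hperm_apply]
    induction z using Lex.rec with
    | h z => rcases z with x | y <;> exact Iff.rfl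
  -- (1) the glued-balanced `2p`-sets: Galois-stable monomials of type `(p,p)`, hence in `B^p ⊗ ℂ` (descent)
  let B : Finset (Set.powersetCard ((Σ i, (K i →+* ℂ)) ⊕ₗ (Σ j, (K' j →+* ℂ))) (2 * p)) :=
    Finset.univ.filter fun s => ∀ τ : ℂ ≃+* ℂ,
      {z | z ∈ (s : Finset ((Σ i, (K i →+* ℂ)) ⊕ₗ (Σ j, (K' j →+* ℂ)))) ∧ P (perm τ z)}.ncard = p ∧
      {z | z ∈ (s : Finset ((Σ i, (K i →+* ℂ)) ⊕ₗ (Σ j, (K' j →+* ℂ)))) ∧ ¬ P (perm τ z)}.ncard = p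
  have hBmem : ∀ s, s ∈ B ↔ ∀ τ : ℂ ≃+* ℂ,
      {z | z ∈ (s : Finset ((Σ i, (K i →+* ℂ)) ⊕ₗ (Σ j, (K' j →+* ℂ)))) ∧ P (perm τ z)}.ncard = p ∧
      {z | z ∈ (s : Finset ((Σ i, (K i →+* ℂ)) ⊕ₗ (Σ j, (K' j →+* ℂ)))) ∧ ¬ P (perm τ z)}.ncard = p :=
    fun s => by simp only [B, Finset.mem_filter, Finset.mem_univ, true_and]
  have hrefl : ∀ z : (Σ i, (K i →+* ℂ)) ⊕ₗ (Σ j, (K' j →+* ℂ)), P (perm (RingEquiv.refl ℂ) z) ↔ P z := by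
    intro z
    rw [hperm_apply]
    induction z using Lex.rec with
    | h z =>
      rcases z with x | y
      · show ((RingEquiv.refl ℂ : ℂ ≃+* ℂ) : ℂ →+* ℂ).comp x.2 ∈ (Φ x.1).1 ↔ x.2 ∈ (Φ x.1).1
        rw [show ((RingEquiv.refl ℂ : ℂ ≃+* ℂ) : ℂ →+* ℂ).comp x.2 = x.2 from RingHom.ext fun _ => rfl]
      · show ((RingEquiv.refl ℂ : ℂ ≃+* ℂ) : ℂ →+* ℂ).comp y.2 ∈ (Φ' y.1).1 ↔ y.2 ∈ (Φ' y.1).1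
        rw [show ((RingEquiv.refl ℂ : ℂ ≃+* ℂ) : ℂ →+* ℂ).comp y.2 = y.2 from RingHom.ext fun _ => rfl]
  have hBt : ∀ s ∈ B, IsOfHodgeType ((⨁ A).prod (⨁ A')).dim ((⨁ A).prod (⨁ A')).X (2 * p) p p (b s) := by
    intro s hs
    obtain ⟨h1, h2⟩ := (hBmem s).1 hs (RingEquiv.refl ℂ)
    have h1' : {z | z ∈ (s : Finset ((Σ i, (K i →+* ℂ)) ⊕ₗ (Σ j, (K' j →+* ℂ)))) ∧ P z}.ncard = p :=
      (congrArg Set.ncard (Set.ext fun z => and_congr_right fun _ => (hrefl z).symm)).trans h1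
    have h2' : {z | z ∈ (s : Finset ((Σ i, (K i →+* ℂ)) ⊕ₗ (Σ j, (K' j →+* ℂ)))) ∧ ¬ P z}.ncard = p :=
      (congrArg Set.ncard (Set.ext fun z => and_congr_right fun _ => not_congr (hrefl z).symm)).trans h2
    have h := isOfHodgeType_monomial hZ hb P hv10 hv01 s
    simp only [h1', h2'] at h
    exact h
  have hBs : ∀ τ, ∀ s ∈ B, Set.powersetCard.map (2 * p) (perm τ) s ∈ B := by
    intro τ s hs
    have hsb := (hBmem s).1 hs
    refine (hBmem _).2 fun τ'' => ?_
    have hcomp : ∀ z : (Σ i, (K i →+* ℂ)) ⊕ₗ (Σ j, (K' j →+* ℂ)),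
        (P (perm τ'' (perm τ z)) ↔ P (perm (τ.trans τ'') z)) := by
      intro z
      rw [hperm_apply, hperm_apply, hperm_apply]
      induction z using Lex.rec with
      | h z =>
        rcases z with x | y
        · show (τ'' : ℂ →+* ℂ).comp ((τ : ℂ →+* ℂ).comp x.2) ∈ (Φ x.1).1 ↔
            ((τ.trans τ'') : ℂ →+* ℂ).comp x.2 ∈ (Φ x.1).1
          rw [RingEquiv.coe_ringHom_trans, RingHom.comp_assoc]
        · show (τ'' : ℂ →+* ℂ).comp ((τ : ℂ →+* ℂ).comp y.2) ∈ (Φ' y.1).1 ↔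
            ((τ.trans τ'') : ℂ →+* ℂ).comp y.2 ∈ (Φ' y.1).1
          rw [RingEquiv.coe_ringHom_trans, RingHom.comp_assoc]
    rw [Set.powersetCard.val_map, ncard_sep_map_eq₃, ncard_sep_map_eq₃]
    obtain ⟨h1, h2⟩ := hsb (τ.trans τ'')
    exact ⟨(congrArg Set.ncard (Set.ext fun z => and_congr_right fun _ => hcomp z)).trans h1,
      (congrArg Set.ncard (Set.ext fun z => and_congr_right fun _ => not_congr (hcomp z))).trans h2⟩
  have hfix : ∀ x : ℂ, (∀ τ : ℂ ≃+* ℂ, (τ : ℂ →+* ℂ) x = x) → x ∈ Set.range (algebraMap ℚ ℂ) :=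
    fun x hx => mem_range_algebraMap_rat_of_forall_ringEquiv₃ hx
  -- the given weight `S` as a `2p`-set of the lexicographic sum
  have hcardS : S.card = 2 * p := by
    have h := ncard_add_ncard_not₃ S (Q (RingEquiv.refl ℂ))
    obtain ⟨h1, h2⟩ := hS (RingEquiv.refl ℂ)
    change {z | z ∈ S ∧ Q (RingEquiv.refl ℂ) z}.ncard = p at h1
    change {z | z ∈ S ∧ ¬ Q (RingEquiv.refl ℂ) z}.ncard = p at h2
    omega
  have hcardS' : (S.map (toLex (α := (Σ i, (K i →+* ℂ)) ⊕ (Σ j, (K' j →+* ℂ)))).toEmbedding).card = 2 * p := by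
    rw [Finset.card_map, hcardS]
  let s₀ : Set.powersetCard ((Σ i, (K i →+* ℂ)) ⊕ₗ (Σ j, (K' j →+* ℂ))) (2 * p) :=
    Set.powersetCard.ofCard hcardS'
  have hs₀val : (s₀ : Finset ((Σ i, (K i →+* ℂ)) ⊕ₗ (Σ j, (K' j →+* ℂ)))) =
      S.map (toLex (α := (Σ i, (K i →+* ℂ)) ⊕ (Σ j, (K' j →+* ℂ)))).toEmbedding := rfl
  have hs₀B : s₀ ∈ B := by
    refine (hBmem s₀).2 fun τ => ?_
    rw [hs₀val, ncard_sep_map_eq₃, ncard_sep_map_eq₃]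
    obtain ⟨h1, h2⟩ := hS τ
    exact ⟨(congrArg Set.ncard (Set.ext fun z => and_congr_right fun _ => hQP τ _)).trans h1,
      (congrArg Set.ncard (Set.ext fun z => and_congr_right fun _ => not_congr (hQP τ _))).trans h2⟩
  have hbS : b s₀ ∈ Submodule.span ℂ {c : complexBetti ((⨁ A).prod (⨁ A')).X (2 * p) |
      IsRationalClass c ∧ IsOfHodgeType ((⨁ A).prod (⨁ A')).dim ((⨁ A).prod (⨁ A')).X (2 * p) p p c} :=
    monomial_mem_span_of_stable hZ hb (RingHom.id ℂ) ev
      (AbelianVariety.prodMap (biproduct.map fun i => ι i (a i)) (biproduct.map fun j => ι' j (a' j))).hom.hom.hom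
      hf hsep (fun τ : ℂ ≃+* ℂ => (τ : ℂ →+* ℂ)) perm hperm hfix (by omega : p + p = 2 * p) B hBt hBs hs₀B
  -- (2) the split `2p`-sets and the span `V` of their monomials; exterior products of Hodge classes lie in `V`
  let Spl : Set (Set.powersetCard ((Σ i, (K i →+* ℂ)) ⊕ₗ (Σ j, (K' j →+* ℂ))) (2 * p)) :=
    {s | ∃ p₁ p₂ : ℕ, p₁ + p₂ = p ∧
      ((s : Finset ((Σ i, (K i →+* ℂ)) ⊕ₗ (Σ j, (K' j →+* ℂ)))).map
        (ofLex (α := (Σ i, (K i →+* ℂ)) ⊕ (Σ j, (K' j →+* ℂ)))).toEmbedding).toLeft ∈ pohlmannSetsAlg Φ p₁ ∧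
      ((s : Finset ((Σ i, (K i →+* ℂ)) ⊕ₗ (Σ j, (K' j →+* ℂ)))).map
        (ofLex (α := (Σ i, (K i →+* ℂ)) ⊕ (Σ j, (K' j →+* ℂ)))).toEmbedding).toRight ∈ pohlmannSetsAlg Φ' p₂}
  set R : ((⨁ A).prod (⨁ A')) ⟶ ((⨁ A).prod (⨁ A')) :=
    AbelianVariety.prodMap (biproduct.map fun i => ι i (a i)) (biproduct.map fun j => ι' j (a' j)) with hRdef
  have hRb : ∀ s : Set.powersetCard ((Σ i, (K i →+* ℂ)) ⊕ₗ (Σ j, (K' j →+* ℂ))) (2 * p),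
      (complexBetti.map R.hom.hom.hom (2 * p)).hom (b s) =
        (∏ z ∈ (s : Finset ((Σ i, (K i →+* ℂ)) ⊕ₗ (Σ j, (K' j →+* ℂ)))), ev z) • b s := fun s => by
    have h := map_monomial_eq_prod_smul hb R.hom.hom.hom hf s
    simp only [RingHom.id_apply] at h
    exact h
  set HP : Set (complexBetti ((⨁ A).prod (⨁ A')).X (2 * p)) := hodgeProductClasses (⨁ A) (⨁ A') p with hHP
  have hspan' : ∀ c : complexBetti ((⨁ A).prod (⨁ A')).X (2 * p), IsRationalClass c →
      IsOfHodgeType ((⨁ A).prod (⨁ A')).dim ((⨁ A).prod (⨁ A')).X (2 * p) p p c → c ∈ Submodule.span ℂ HP := by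
    intro c hcQ hcH
    rw [Motives.AbelianVariety.dim_prod] at hcH
    exact hspan p c hcQ hcH
  have hprod : Submodule.span ℂ HP ≤ Submodule.span ℂ (b '' Spl) := by
    refine Submodule.span_le.2 ?_
    rintro x ⟨l, k, hlk, α, β, hαQ, hαH, hβQ, hβH, rfl⟩
    -- Pohlmann (`⊆`) on the factors
    have hα : α ∈ Submodule.span ℂ (⋃ T₁ ∈ pohlmannSetsAlg Φ l, (weightClassesAlg A ι (2 * l) T₁ :
        Set (complexBetti (⨁ A).X (2 * l)))) := by
      have h := mem_iSup_weightClassesAlg hA hαQ hαH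
      rwa [show (⨆ T₁ ∈ pohlmannSetsAlg Φ l, weightClassesAlg A ι (2 * l) T₁) =
        Submodule.span ℂ (⋃ T₁ ∈ pohlmannSetsAlg Φ l, (weightClassesAlg A ι (2 * l) T₁ :
          Set (complexBetti (⨁ A).X (2 * l)))) by
        rw [Submodule.span_iUnion₂]; simp_rw [Submodule.span_eq]] at h
    have hβ : β ∈ Submodule.span ℂ (⋃ T₂ ∈ pohlmannSetsAlg Φ' k, (weightClassesAlg A' ι' (2 * k) T₂ :
        Set (complexBetti (⨁ A').X (2 * k)))) := by
      have h := mem_iSup_weightClassesAlg hA' hβQ hβH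
      rwa [show (⨆ T₂ ∈ pohlmannSetsAlg Φ' k, weightClassesAlg A' ι' (2 * k) T₂) =
        Submodule.span ℂ (⋃ T₂ ∈ pohlmannSetsAlg Φ' k, (weightClassesAlg A' ι' (2 * k) T₂ :
          Set (complexBetti (⨁ A').X (2 * k)))) by
        rw [Submodule.span_iUnion₂]; simp_rw [Submodule.span_eq]] at h
    have hmem := cupProduct_map_map_mem_span hlk
      (complexBetti.map (AbelianVariety.fst (⨁ A) (⨁ A')).hom.hom.hom (2 * l)).hom
      (complexBetti.map (AbelianVariety.snd (⨁ A) (⨁ A')).hom.hom.hom (2 * k)).hom hα hβ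
    refine (Submodule.span_le.2 ?_) hmem
    rintro _ ⟨α₁, hα₁, β₁, hβ₁, rfl⟩
    obtain ⟨T₁, hT₁, hα₁T⟩ := Set.mem_iUnion₂.1 hα₁
    obtain ⟨T₂, hT₂, hβ₁T⟩ := Set.mem_iUnion₂.1 hβ₁
    -- the exterior product of two weight classes is an `R`-eigenvector for the eigenvalue of the split set `T₁ ⊔ T₂`
    set y := cupProduct (X := ComplexPoints ((⨁ A).prod (⨁ A')).X) hlk
      ((complexBetti.map (AbelianVariety.fst (⨁ A) (⨁ A')).hom.hom.hom (2 * l)).hom α₁)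
      ((complexBetti.map (AbelianVariety.snd (⨁ A) (⨁ A')).hom.hom.hom (2 * k)).hom β₁) with hydef
    have hRα : complexBetti.map R.hom.hom.hom (2 * l)
        (complexBetti.map (AbelianVariety.fst (⨁ A) (⨁ A')).hom.hom.hom (2 * l) α₁) =
        (∏ x ∈ T₁, x.2 ((a x.1 : 𝓞 (K x.1)) : K x.1)) •
          complexBetti.map (AbelianVariety.fst (⨁ A) (⨁ A')).hom.hom.hom (2 * l) α₁ := by
      have e := abelianVarietyHom_map_map_apply R (AbelianVariety.fst (⨁ A) (⨁ A')) α₁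
      rw [hRdef, AbelianVariety.prodMap_fst, ← abelianVarietyHom_map_map_apply] at e
      rw [← hRdef] at e
      rw [e]
      change complexBetti.map (AbelianVariety.fst (⨁ A) (⨁ A')).hom.hom.hom (2 * l)
        (complexBetti.map (biproduct.map fun i => ι i (a i)).hom.hom.hom (2 * l) α₁) = _
      rw [mem_weightClassesAlg_iff.1 hα₁T a, map_smul]
    have hRβ : complexBetti.map R.hom.hom.hom (2 * k)
        (complexBetti.map (AbelianVariety.snd (⨁ A) (⨁ A')).hom.hom.hom (2 * k) β₁) =
        (∏ y ∈ T₂, y.2 ((a' y.1 : 𝓞 (K' y.1)) : K' y.1)) •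
          complexBetti.map (AbelianVariety.snd (⨁ A) (⨁ A')).hom.hom.hom (2 * k) β₁ := by
      have e := abelianVarietyHom_map_map_apply R (AbelianVariety.snd (⨁ A) (⨁ A')) β₁
      rw [hRdef, AbelianVariety.prodMap_snd, ← abelianVarietyHom_map_map_apply] at e
      rw [← hRdef] at e
      rw [e]
      change complexBetti.map (AbelianVariety.snd (⨁ A) (⨁ A')).hom.hom.hom (2 * k)
        (complexBetti.map (biproduct.map fun j => ι' j (a' j)).hom.hom.hom (2 * k) β₁) = _
      rw [mem_weightClassesAlg_iff.1 hβ₁T a', map_smul]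
    have hRy : (complexBetti.map R.hom.hom.hom (2 * p)).hom y =
        ((∏ x ∈ T₁, x.2 ((a x.1 : 𝓞 (K x.1)) : K x.1)) * ∏ y ∈ T₂, y.2 ((a' y.1 : 𝓞 (K' y.1)) : K' y.1)) • y := by
      rw [hydef]
      change complexBetti.map R.hom.hom.hom (2 * p) (cupProduct hlk _ _) = _
      rw [cupProduct_map _ hlk, hRα, hRβ, LinearMap.map_smul₂, map_smul, smul_smul]
    -- the split set `T₁ ⊔ T₂` as a `2p`-set
    have hcardT : ((T₁.disjSum T₂).map
        (toLex (α := (Σ i, (K i →+* ℂ)) ⊕ (Σ j, (K' j →+* ℂ)))).toEmbedding).card = 2 * p := by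
      rw [Finset.card_map, Finset.card_disjSum, hT₁.1, hT₂.1]; omega
    let t : Set.powersetCard ((Σ i, (K i →+* ℂ)) ⊕ₗ (Σ j, (K' j →+* ℂ))) (2 * p) :=
      Set.powersetCard.ofCard hcardT
    have htval : (t : Finset ((Σ i, (K i →+* ℂ)) ⊕ₗ (Σ j, (K' j →+* ℂ)))) = (T₁.disjSum T₂).map
        (toLex (α := (Σ i, (K i →+* ℂ)) ⊕ (Σ j, (K' j →+* ℂ)))).toEmbedding := rfl
    have hevt : ∏ z ∈ (t : Finset ((Σ i, (K i →+* ℂ)) ⊕ₗ (Σ j, (K' j →+* ℂ)))), ev z =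
        (∏ x ∈ T₁, x.2 ((a x.1 : 𝓞 (K x.1)) : K x.1)) * ∏ y ∈ T₂, y.2 ((a' y.1 : 𝓞 (K' y.1)) : K' y.1) := by
      rw [htval, Finset.prod_map, Finset.prod_disjSum]
      rfl
    have htSpl : t ∈ Spl := by
      refine ⟨l, k, by omega, ?_, ?_⟩
      · rw [htval, Finset.map_map, show (toLex (α := (Σ i, (K i →+* ℂ)) ⊕ (Σ j, (K' j →+* ℂ)))).toEmbedding.trans
            (ofLex (α := (Σ i, (K i →+* ℂ)) ⊕ (Σ j, (K' j →+* ℂ)))).toEmbedding = Function.Embedding.refl _ from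
            rfl, Finset.map_refl, Finset.toLeft_disjSum]
        exact hT₁
      · rw [htval, Finset.map_map, show (toLex (α := (Σ i, (K i →+* ℂ)) ⊕ (Σ j, (K' j →+* ℂ)))).toEmbedding.trans
            (ofLex (α := (Σ i, (K i →+* ℂ)) ⊕ (Σ j, (K' j →+* ℂ)))).toEmbedding = Function.Embedding.refl _ from
            rfl, Finset.map_refl, Finset.toRight_disjSum]
        exact hT₂
    -- `y` is a multiple of `b t`
    have hy : y ∈ ℂ ∙ b t := by
      refine mem_span_singleton_of_apply_eq_smul₃ b (complexBetti.map R.hom.hom.hom (2 * p)).hom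
        (fun s => ∏ z ∈ (s : Finset ((Σ i, (K i →+* ℂ)) ⊕ₗ (Σ j, (K' j →+* ℂ)))), ev z) hRb hsep ?_
      rw [hevt]
      exact hRy
    have hsub : ({b t} : Set (complexBetti ((⨁ A).prod (⨁ A')).X (2 * p))) ⊆ b '' Spl :=
      Set.singleton_subset_iff.2 ⟨t, htSpl, rfl⟩
    have hyV : y ∈ Submodule.span ℂ (b '' Spl) := Submodule.span_mono hsub hy
    exact hyV
  -- (3) `b s₀ ∈ span (b '' Spl)`, hence `s₀` splits
  have hle : Submodule.span ℂ {c : complexBetti ((⨁ A).prod (⨁ A')).X (2 * p) |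
      IsRationalClass c ∧ IsOfHodgeType ((⨁ A).prod (⨁ A')).dim ((⨁ A).prod (⨁ A')).X (2 * p) p p c} ≤
      Submodule.span ℂ (b '' Spl) :=
    Submodule.span_le.2 fun c hc => hprod (hspan' c hc.1 hc.2)
  have hs₀Spl : s₀ ∈ Spl := b.self_mem_span_image.1 (hle hbS)
  obtain ⟨p₁, p₂, hp, h₁, h₂⟩ := hs₀Spl
  rw [hs₀val, Finset.map_map, show (toLex (α := (Σ i, (K i →+* ℂ)) ⊕ (Σ j, (K' j →+* ℂ)))).toEmbedding.trans
      (ofLex (α := (Σ i, (K i →+* ℂ)) ⊕ (Σ j, (K' j →+* ℂ)))).toEmbedding = Function.Embedding.refl _ from rfl,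
    Finset.map_refl] at h₁ h₂
  exact ⟨p₁, p₂, hp, h₁, h₂⟩

/-- **`HodgeClassesProductSpan (⨁ A) (⨁ A')` ⟺ every glued-balanced weight splits into balanced blocks** — the exact
weight-by-weight form of Moonen–Zarhin's criterion (3.1) for the pair `(⨁ A, ⨁ A')` (⟸ is
`hodgeClassesProductSpan_biproduct_of_blocksSplit`). [cite: MoonenZarhin1999LowDim, §3 (3.1)] [cite: GaoUllmo2025, Thm. 3.1 with proof] -/
theorem hodgeClassesProductSpan_biproduct_iff_blocksSplit
    (hA : ∀ i, IsCMTypeRealisation (Φ i) (A i) (ι i) (θ i))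
    (hA' : ∀ j, IsCMTypeRealisation (Φ' j) (A' j) (ι' j) (θ' j)) :
    HodgeClassesProductSpan (⨁ A) (⨁ A') ↔
      ∀ (S : Finset ((Σ i, (K i →+* ℂ)) ⊕ (Σ j, (K' j →+* ℂ)))) (p : ℕ),
        (∀ τ : ℂ ≃+* ℂ,
          {z | z ∈ S ∧ Sum.elim (fun x : (Σ i, (K i →+* ℂ)) => (τ : ℂ →+* ℂ).comp x.2 ∈ (Φ x.1).1)
            (fun y : (Σ j, (K' j →+* ℂ)) => (τ : ℂ →+* ℂ).comp y.2 ∈ (Φ' y.1).1) z}.ncard = p ∧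
          {z | z ∈ S ∧ ¬ Sum.elim (fun x : (Σ i, (K i →+* ℂ)) => (τ : ℂ →+* ℂ).comp x.2 ∈ (Φ x.1).1)
            (fun y : (Σ j, (K' j →+* ℂ)) => (τ : ℂ →+* ℂ).comp y.2 ∈ (Φ' y.1).1) z}.ncard = p) →
        ∃ p₁ p₂ : ℕ, p₁ + p₂ = p ∧ S.toLeft ∈ pohlmannSetsAlg Φ p₁ ∧ S.toRight ∈ pohlmannSetsAlg Φ' p₂ :=
  ⟨fun h S p hS => blocksSplit_of_hodgeClassesProductSpan_biproduct hA hA' h S p hS,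
    fun h => hodgeClassesProductSpan_biproduct_of_blocksSplit hA hA' h⟩

end Main

end Literature.AlgebraicGeometry.Pohlmann1968

end
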